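import Summits.QuantumFields.BalabanUV.Beta.FP.PeriodisedSymBorderWardContact
import Summits.QuantumFields.BalabanUV.Beta.FP.PeriodisedBorderWardContactInstance

/-!
# `BalabanUV.Beta.FP.PeriodisedSymBorderWardContactInstance` — road «FP» for binder row D1, ROUTE T, the dictionary's (J-a) «THE DOOR AT THE LITERAL OF
# RECORD (chart (III′))», item (α-1b) of an2's `JA-TABLE.v1.md`: **THE ORDER-1 MOVING-FRAME LETTER `c1` AT THE (III′) TORUS CALL's TYPES** — the sym twin
# of p314580 `FP/PeriodisedBorderWardContactInstance` with the shifted spread's averaging rows `Q₁₀ := perF F (bhKStepSh d N (Dsh N) j)∘((coarsePt, inr), fields)`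
# and the symmetrised border table `Q₁₁^{b} := perF F (dper F (symVhSAt ρ_c d N rfl b.2 b.1))∘…`, the comb at the CENTRED root `ρ_c = ctr (d+1) N`

WHAT.  §1 the two blocks of `Q₁₁^{(κ,u)} · [D₂ | D₁]`: **`symQ11_mul_D1_apply`** (residual block — the tip contact, from (α-1b)
`PeriodisedSymBorderWardContact.submatrix_symVhSAt_mul_tgrad_of_not_root`; the residual parameters `Res (ctr (d+1) N) N (fine N M′)` are non-roots by
`TorusCombRows.ne_rootOf_iff_proj_ne` at `toSite (ctrOff (d+1) N) = ctr (d+1) N`), **`symQ11_mul_D2_apply`** (block-constant block — the block of the tip minus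
the block of the far endpoint of the coarse bond, `tgradBlock_eq_sum_tgrad_mul` + `submatrix_symVhSAt_mul_tgrad` + `quo_zsmul_add_toSite'`).  §2
**`torus_c1_symVhSAt`**: `Q₁₁^{(κ,u)} * fromCols D₂ D₁ + Q₁₀ * W₁^{(κ,u)} = fromCols D̄₁^{(κ,u)} 0` with the ULTRALOCAL generator jet `W₁^{(κ,u)}` (row `(u,κ)`, reads
the TIP: `−c_j · Sum.elim (tdelta M′ (quo N (u + e_κ)) ·) (tdelta F (u + e_κ) ·)`) and the coarse jet `D̄₁^{(κ,u)}((p̄,m), t̄) = −c_j · Q₁₀((p̄,m),(u,κ)) · [t̄ = p̄ + e_m]` —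
the SAME jets as the rooted letter (JA-TABLE §1: «`X`, `X̄` unchanged»; the generator side is chart-independent).  §3 **`torus_c1_symVhSAt_weighted`** (any bond
weight `h`, by the rooted file's `weighted_letter` BY NAME) — the `c1` SUPPLIER of (β) `…RowsGradedLevelZeroSym`, in the exact shape
`NestedStepLawTorusTransportedRowsGraded` consumes p314580 (`(by rw [hQ₁₁ h]; exact torus_c1_symVhSAt_weighted M′ j h hQ₁₀ hD₁ hD₂)`).  [folklore] finite
sums BY NAME; no `def`, no `def … : Prop`, nothing cited, 0 sorry.  Nothing of the dictionary ∕ Bałaban's asserted.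

HONEST DEPENDENCY (page 1, mandatory): continuum YM on T⁴ ⇐ BetaPertH ∧ nine spine estimates (0/9 proved); BetaPertH ⇐ (D1) ∧ (D4) ∧ CAP+tail;
G-an2-4 gates asym, D1 and NE2/3/4.  HONEST FRAMING (cell contract, verbatim): «discharging `BetaPertH` makes Bałaban's UV stability UNCONDITIONAL —
a real constructive-QFT result; it is NOT the continuum limit and NOT the Clay problem.»  ABSOLUTE RULE (cell charter, verbatim): «No internally-minted
statement may enter as a cited fact. Every hypothesis is either kernel-proved in this package or a verbatim quotation of a PUBLISHED theorem with page
reference. The manuscript(s) under audit are NOT citable for their own disputed steps — they are the thing under adjudication; programme-internal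
(2001/route/tribunal) claims are never citable.»  0 estimates; 0∕4 row-D1 binders; NOT (T-ID), NOT (J-a) complete, NOT SDF, NOT D1, NOT BetaPertH, NOT
continuum, NOT Clay.  D1 formalisation swarm LEAF PROVER 02 (b2b-balaban-beta-d1-formalise-leaf-02 gen 21), 2026-08-22.  No existing file touched.
-/

noncomputable section

open scoped BigOperators

namespace Summit.QuantumFields.BalabanUV.Beta.FP.PeriodisedSymBorderWardContactInstance

open Finset Matrix
open Literature.Probability.LatticeModels (Torus.proj)
open Literature.MathematicalPhysics.QuantumFieldTheory.Balaban1983to89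
open Literature.MathematicalPhysics.QuantumFieldTheory.Balaban1983to89.Beta
open Literature.MathematicalPhysics.QuantumFieldTheory.LatticeForm (quo)
open B5Prop11Plancherel (fine)
open B6Lemma24Torus (pbox)
open AffineAveraging (Site box toSite unitVec)
open AveragingContoursRooted (ctr ctrOff ctrOff_mem_box)
open OneStepResolventKernel (Fib)
open Summit.QuantumFields.BalabanUV.Beta.BorderedHessian (stepScale)
open Summit.QuantumFields.BalabanUV.Beta.DshAn1 (Dsh)
open Summit.QuantumFields.BalabanUV.Beta.SymAveragingHessianCounts (symVhSAt)
open Summit.QuantumFields.BalabanUV.Beta.SymShiftedSpread (bhKStepSh)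
open Summit.QuantumFields.BalabanUV.Beta.FP.KernelPeriodisationFib (Idx perF)
open Summit.QuantumFields.BalabanUV.Beta.FP.KernelPeriodisationFibLoc (dper)
open Summit.QuantumFields.BalabanUV.Beta.FP.TorusGaugeCovariance (tdelta tgrad)
open Summit.QuantumFields.BalabanUV.Beta.FP.TorusGaugeCovariancePairing (sum_tdelta_mul)
open Summit.QuantumFields.BalabanUV.Beta.FP.TorusGaugeCovarianceCoarse (tgradBlock tgradBlock_eq_sum_tgrad_mul coarsePt coarsePt_coe proj_coarsePt
  tdelta_quo_wrapPt quo_zsmul_add_toSite')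
open Summit.QuantumFields.BalabanUV.Beta.FP.TorusCombRows (Res ne_rootOf_iff_proj_ne)
open Summit.QuantumFields.BalabanUV.Beta.GAN24.FineReadoutCauchyFrame (toSite_mem_range)
open Summit.QuantumFields.BalabanUV.Beta.FP.PeriodisedSymBorderWardContact (submatrix_symVhSAt_mul_tgrad submatrix_symVhSAt_mul_tgrad_of_not_root)
open Summit.QuantumFields.BalabanUV.Beta.FP.PeriodisedBorderWardContactInstance (mul_oneRow_apply weighted_letter)

variable {d : ℕ} (M' : Fin (d + 1) → ℕ) [∀ μ, NeZero (M' μ)] {N : ℕ} [NeZero N] {r' : Fin (d + 1) → ℕ}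

/-! ## §1 The two blocks of `Q₁₁^{(κ,u)} · [D₂ | D₁]` -/

/-- [folklore] **RESIDUAL BLOCK — THE TIP CONTACT** (sym twin of `PeriodisedBorderWardContactInstance.Q11_mul_D1_apply`; root `ρ_c = ctr (d+1) N`): `(Q₁₁^{(κ,u)} · D₁)((p̄,m), s) = tdelta F (u + e_κ) s · c · Q₁₀((p̄,m), (u,κ))` (`s` a residual parameter, i.e. a
non-root box point; the far contact point `N•p̄ + ρ + N•e_m` is a root). -/
theorem symQ11_mul_D1_apply (j : ℕ) (κ : Fin (d + 1)) (u : ↥(pbox (fine N M')))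
    {Q₁₀ Q₁₁ : Matrix (↥(pbox M') × Fin (d + 1)) (↥(pbox (fine N M')) × Fin (d + 1)) ℝ}
    {D₁ : Matrix (↥(pbox (fine N M')) × Fin (d + 1)) (Res (ctr (d + 1) N) N (fine N M')) ℝ}
    (hQ₁₀ : Q₁₀ = (perF (fine N M') (bhKStepSh d N (Dsh N) j)).submatrix
        (fun a : ↥(pbox M') × Fin (d + 1) => ((coarsePt M' N a.1, Sum.inr a.2) : Idx (fine N M') (Fib d)))
        (fun b : ↥(pbox (fine N M')) × Fin (d + 1) => ((b.1, Sum.inl b.2) : Idx (fine N M') (Fib d))))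
    (hQ₁₁ : Q₁₁ = (perF (fine N M') (dper (fine N M') (symVhSAt (ctr (d + 1) N) d N rfl κ (u : Site (d + 1))))).submatrix
        (fun a : ↥(pbox M') × Fin (d + 1) => ((coarsePt M' N a.1, Sum.inr a.2) : Idx (fine N M') (Fib d)))
        (fun b : ↥(pbox (fine N M')) × Fin (d + 1) => ((b.1, Sum.inl b.2) : Idx (fine N M') (Fib d))))
    (hD₁ : D₁ = (tgrad (fine N M')).submatrix (fun b : ↥(pbox (fine N M')) × Fin (d + 1) => ((b.1, Sum.inl b.2) : Idx (fine N M') (Fib d)))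
        (Subtype.val : Res (ctr (d + 1) N) N (fine N M') → ↥(pbox (fine N M'))))
    (a : ↥(pbox M') × Fin (d + 1)) (s : Res (ctr (d + 1) N) N (fine N M')) :
    (Q₁₁ * D₁) a s = tdelta (fine N M') ((u : Site (d + 1)) + unitVec κ) s.1 * ((((N : ℝ) ^ (d + 1) * stepScale d N j)⁻¹) * Q₁₀ a (u, κ)) := by
  have hN : 0 < N := Nat.pos_of_ne_zero (NeZero.ne N)
  have hN1 : 1 ≤ N := hN
  subst hQ₁₀ hQ₁₁ hD₁
  exact submatrix_symVhSAt_mul_tgrad_of_not_root (M := fine N M') (M' := M') (fun _ => rfl) j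
    (fun a : ↥(pbox M') × Fin (d + 1) => ((coarsePt M' N a.1 : ↥(pbox (fine N M'))) : Site (d + 1))) (fun a => (coarsePt M' N a.1).2)
    (fun a => a.2) Subtype.val
    (fun s : Res (ctr (d + 1) N) N (fine N M') => (ne_rootOf_iff_proj_ne hN (toSite_mem_range (ctrOff_mem_box hN1)) s.site).1 s.not_root) κ u a s

/-- [folklore] **BLOCK-CONSTANT BLOCK** (sym twin of `Q11_mul_D2_apply`): `(Q₁₁^{(κ,u)} · D₂)((p̄,m), t̄) = c · Q₁₀((p̄,m), (u,κ)) · (tdelta M′ (quo N (u + e_κ)) t̄ − tdelta M′ (p̄ + e_m) t̄)` — the block of the tip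
minus the block of the far endpoint of the coarse bond `(m, p̄)` (`tgradBlock_eq_sum_tgrad_mul`, `sum_tdelta_mul`, `quo_zsmul_add_toSite'`). -/
theorem symQ11_mul_D2_apply (j : ℕ) (κ : Fin (d + 1)) (u : ↥(pbox (fine N M')))
    {Q₁₀ Q₁₁ : Matrix (↥(pbox M') × Fin (d + 1)) (↥(pbox (fine N M')) × Fin (d + 1)) ℝ}
    {D₂ : Matrix (↥(pbox (fine N M')) × Fin (d + 1)) (Res (toSite r') N M') ℝ}
    (hQ₁₀ : Q₁₀ = (perF (fine N M') (bhKStepSh d N (Dsh N) j)).submatrix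
        (fun a : ↥(pbox M') × Fin (d + 1) => ((coarsePt M' N a.1, Sum.inr a.2) : Idx (fine N M') (Fib d)))
        (fun b : ↥(pbox (fine N M')) × Fin (d + 1) => ((b.1, Sum.inl b.2) : Idx (fine N M') (Fib d))))
    (hQ₁₁ : Q₁₁ = (perF (fine N M') (dper (fine N M') (symVhSAt (ctr (d + 1) N) d N rfl κ (u : Site (d + 1))))).submatrix
        (fun a : ↥(pbox M') × Fin (d + 1) => ((coarsePt M' N a.1, Sum.inr a.2) : Idx (fine N M') (Fib d)))
        (fun b : ↥(pbox (fine N M')) × Fin (d + 1) => ((b.1, Sum.inl b.2) : Idx (fine N M') (Fib d))))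
    (hD₂ : D₂ = (tgradBlock M' N).submatrix (fun b : ↥(pbox (fine N M')) × Fin (d + 1) => ((b.1, Sum.inl b.2) : Idx (fine N M') (Fib d)))
        (Subtype.val : Res (toSite r') N M' → ↥(pbox M')))
    (a : ↥(pbox M') × Fin (d + 1)) (t : Res (toSite r') N M') :
    (Q₁₁ * D₂) a t
      = ((((N : ℝ) ^ (d + 1) * stepScale d N j)⁻¹) * Q₁₀ a (u, κ))
        * (tdelta M' (quo N ((u : Site (d + 1)) + unitVec κ)) t.1 - tdelta M' ((a.1 : Site (d + 1)) + unitVec a.2) t.1) := by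
  have hN1 : 1 ≤ N := Nat.pos_of_ne_zero (NeZero.ne N)
  subst hQ₁₀ hQ₁₁ hD₂
  -- expand the block column over the `tgrad` columns and exchange the finite sums
  set Q11 := (perF (fine N M') (dper (fine N M') (symVhSAt (ctr (d + 1) N) d N rfl κ (u : Site (d + 1))))).submatrix
          (fun a : ↥(pbox M') × Fin (d + 1) => ((coarsePt M' N a.1, Sum.inr a.2) : Idx (fine N M') (Fib d)))
          (fun b : ↥(pbox (fine N M')) × Fin (d + 1) => ((b.1, Sum.inl b.2) : Idx (fine N M') (Fib d))) with hQ11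
  have hx : (Q11 * (tgradBlock M' N).submatrix (fun b : ↥(pbox (fine N M')) × Fin (d + 1) => ((b.1, Sum.inl b.2) : Idx (fine N M') (Fib d)))
        (Subtype.val : Res (toSite r') N M' → ↥(pbox M'))) a t
      = ∑ s : ↥(pbox (fine N M')), (Q11 * (tgrad (fine N M')).submatrix
            (fun b : ↥(pbox (fine N M')) × Fin (d + 1) => ((b.1, Sum.inl b.2) : Idx (fine N M') (Fib d))) id) a s
          * tdelta M' (quo N (s : Site (d + 1))) t.1 := by
    simp only [Matrix.mul_apply, Matrix.submatrix_apply, id_eq, tgradBlock_eq_sum_tgrad_mul, Finset.mul_sum, Finset.sum_mul, mul_assoc]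
    exact Finset.sum_comm
  refine hx.trans ?_
  have hcol : ∀ s : ↥(pbox (fine N M')), (Q11 * (tgrad (fine N M')).submatrix
        (fun b : ↥(pbox (fine N M')) × Fin (d + 1) => ((b.1, Sum.inl b.2) : Idx (fine N M') (Fib d))) id) a s
      = (tdelta (fine N M') ((u : Site (d + 1)) + unitVec κ) s - tdelta (fine N M') ((coarsePt M' N a.1 : Site (d + 1)) + ctr (d + 1) N + (N : ℤ) • unitVec a.2) s)
        * ((((N : ℝ) ^ (d + 1) * stepScale d N j)⁻¹)
          * (perF (fine N M') (bhKStepSh d N (Dsh N) j)).submatrix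
              (fun a : ↥(pbox M') × Fin (d + 1) => ((coarsePt M' N a.1, Sum.inr a.2) : Idx (fine N M') (Fib d)))
              (fun b : ↥(pbox (fine N M')) × Fin (d + 1) => ((b.1, Sum.inl b.2) : Idx (fine N M') (Fib d))) a (u, κ)) := fun s =>
    submatrix_symVhSAt_mul_tgrad (M := fine N M') (M' := M') (fun _ => rfl) j
      (fun a : ↥(pbox M') × Fin (d + 1) => ((coarsePt M' N a.1 : ↥(pbox (fine N M'))) : Site (d + 1))) (fun a => (coarsePt M' N a.1).2)
      (fun a => a.2) id κ u a s
  simp only [hcol]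
  set cQ : ℝ := (((N : ℝ) ^ (d + 1) * stepScale d N j)⁻¹)
          * (perF (fine N M') (bhKStepSh d N (Dsh N) j)).submatrix
              (fun a : ↥(pbox M') × Fin (d + 1) => ((coarsePt M' N a.1, Sum.inr a.2) : Idx (fine N M') (Fib d)))
              (fun b : ↥(pbox (fine N M')) × Fin (d + 1) => ((b.1, Sum.inl b.2) : Idx (fine N M') (Fib d))) a (u, κ) with hcQ
  have hre : ∀ s' : ↥(pbox (fine N M')),
      (tdelta (fine N M') ((u : Site (d + 1)) + unitVec κ) s' - tdelta (fine N M') ((coarsePt M' N a.1 : Site (d + 1)) + ctr (d + 1) N + (N : ℤ) • unitVec a.2) s')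
          * cQ * tdelta M' (quo N (s' : Site (d + 1))) t.1
        = cQ * (tdelta (fine N M') ((u : Site (d + 1)) + unitVec κ) s' * tdelta M' (quo N (s' : Site (d + 1))) t.1
          - tdelta (fine N M') ((coarsePt M' N a.1 : Site (d + 1)) + ctr (d + 1) N + (N : ℤ) • unitVec a.2) s' * tdelta M' (quo N (s' : Site (d + 1))) t.1) :=
    fun s' => by ring
  rw [Finset.sum_congr rfl fun s' _ => hre s', ← Finset.mul_sum, Finset.sum_sub_distrib, sum_tdelta_mul, sum_tdelta_mul, tdelta_quo_wrapPt,
    tdelta_quo_wrapPt, coarsePt_coe,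
    show (N : ℤ) • (a.1 : Site (d + 1)) + ctr (d + 1) N + (N : ℤ) • unitVec a.2 = (N : ℤ) • ((a.1 : Site (d + 1)) + unitVec a.2) + ctr (d + 1) N by
      rw [smul_add]; abel,
    show ctr (d + 1) N = toSite (ctrOff (d + 1) N) from rfl, quo_zsmul_add_toSite' (ctrOff_mem_box hN1)]

/-! ## §2 The moving-frame letter `c1` at the (III′) tables, with the two jets explicit -/

/-- [folklore] **`torus_c1_symVhSAt` — THE ORDER-1 MOVING-FRAME LETTER OF p308750 AT THE (III′) TORUS CALL's TYPES (shifted spread `𝕄_j`, symmetrised border table `symVhSAt ρ_c`), SINGLE-BOND INSERTION `(κ, u)`** (sym twin of `torus_c1_vhSAt`):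
`Q₁₁ * fromCols D₂ D₁ + Q₁₀ * W₁ = fromCols D̄₁ 0` with the ULTRALOCAL generator jet
`W₁ := of (fun b e => [b = (u,κ)] · (−c) · (Sum.elim (fun t̄ => tdelta M′ (quo N (u + e_κ)) t̄) (fun s => tdelta F (u + e_κ) s) e))` (row `(u,κ)` only; it reads the TIP)
and the coarse jet `D̄₁ := of (fun (p̄,m) t̄ => −c · Q₁₀ (p̄,m) (u,κ) · tdelta M′ (p̄ + e_m) t̄)`, `c = (N^{d+1}·stepScale d N j)⁻¹`; the torus objects by their
defining equations (instantiate with `rfl`). -/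
theorem torus_c1_symVhSAt (j : ℕ) (κ : Fin (d + 1)) (u : ↥(pbox (fine N M')))
    {Q₁₀ Q₁₁ : Matrix (↥(pbox M') × Fin (d + 1)) (↥(pbox (fine N M')) × Fin (d + 1)) ℝ}
    {D₁ : Matrix (↥(pbox (fine N M')) × Fin (d + 1)) (Res (ctr (d + 1) N) N (fine N M')) ℝ}
    {D₂ : Matrix (↥(pbox (fine N M')) × Fin (d + 1)) (Res (toSite r') N M') ℝ}
    (hQ₁₀ : Q₁₀ = (perF (fine N M') (bhKStepSh d N (Dsh N) j)).submatrix
        (fun a : ↥(pbox M') × Fin (d + 1) => ((coarsePt M' N a.1, Sum.inr a.2) : Idx (fine N M') (Fib d)))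
        (fun b : ↥(pbox (fine N M')) × Fin (d + 1) => ((b.1, Sum.inl b.2) : Idx (fine N M') (Fib d))))
    (hQ₁₁ : Q₁₁ = (perF (fine N M') (dper (fine N M') (symVhSAt (ctr (d + 1) N) d N rfl κ (u : Site (d + 1))))).submatrix
        (fun a : ↥(pbox M') × Fin (d + 1) => ((coarsePt M' N a.1, Sum.inr a.2) : Idx (fine N M') (Fib d)))
        (fun b : ↥(pbox (fine N M')) × Fin (d + 1) => ((b.1, Sum.inl b.2) : Idx (fine N M') (Fib d))))
    (hD₁ : D₁ = (tgrad (fine N M')).submatrix (fun b : ↥(pbox (fine N M')) × Fin (d + 1) => ((b.1, Sum.inl b.2) : Idx (fine N M') (Fib d)))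
        (Subtype.val : Res (ctr (d + 1) N) N (fine N M') → ↥(pbox (fine N M'))))
    (hD₂ : D₂ = (tgradBlock M' N).submatrix (fun b : ↥(pbox (fine N M')) × Fin (d + 1) => ((b.1, Sum.inl b.2) : Idx (fine N M') (Fib d)))
        (Subtype.val : Res (toSite r') N M' → ↥(pbox M'))) :
    Q₁₁ * fromCols D₂ D₁
        + Q₁₀ * Matrix.of (fun (b : ↥(pbox (fine N M')) × Fin (d + 1)) (e : Res (toSite r') N M' ⊕ Res (ctr (d + 1) N) N (fine N M')) =>
            if b = (u, κ) then
              -((((N : ℝ) ^ (d + 1) * stepScale d N j)⁻¹)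
                * Sum.elim (fun t : Res (toSite r') N M' => tdelta M' (quo N ((u : Site (d + 1)) + unitVec κ)) t.1)
                    (fun s : Res (ctr (d + 1) N) N (fine N M') => tdelta (fine N M') ((u : Site (d + 1)) + unitVec κ) s.1) e)
            else 0)
      = fromCols
          (Matrix.of fun (a : ↥(pbox M') × Fin (d + 1)) (t : Res (toSite r') N M') =>
            -((((N : ℝ) ^ (d + 1) * stepScale d N j)⁻¹) * Q₁₀ a (u, κ) * tdelta M' ((a.1 : Site (d + 1)) + unitVec a.2) t.1))
          (0 : Matrix (↥(pbox M') × Fin (d + 1)) (Res (ctr (d + 1) N) N (fine N M')) ℝ) := by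
  ext a e
  rw [Matrix.add_apply, mul_oneRow_apply, Matrix.mul_fromCols]
  rcases e with t | s
  · rw [fromCols_apply_inl, fromCols_apply_inl, Matrix.of_apply, symQ11_mul_D2_apply M' j κ u hQ₁₀ hQ₁₁ hD₂ a t]
    simp only [Sum.elim_inl]
    ring
  · rw [fromCols_apply_inr, fromCols_apply_inr, Matrix.zero_apply, symQ11_mul_D1_apply M' j κ u hQ₁₀ hQ₁₁ hD₁ a s]
    simp only [Sum.elim_inr]
    ring

/-! ## §3 Weighted insertions (any bond weight on the torus), by linearity -/

/-- [folklore] **`torus_c1_symVhSAt_weighted` — THE ORDER-1 MOVING-FRAME LETTER FOR ANY BOND WEIGHT `h` ON THE TORUS, (III′) TABLES** (sym twin of `torus_c1_vhSAt_weighted`; the `c1` supplier of (β) `…RowsGradedLevelZeroSym`): with `Q₁₁(h) := Σ_b h b • Q₁₁^{b}`,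
`W₁(h) := Σ_b h b • W₁^{b}`, `D̄₁(h) := Σ_b h b • D̄₁^{b}` (the single-bond objects of `torus_c1_symVhSAt`, `b = (u, κ)`), `Q₁₁(h) * [D₂|D₁] + Q₁₀ * W₁(h) = [D̄₁(h) | 0]`. -/
theorem torus_c1_symVhSAt_weighted (j : ℕ) (h : ↥(pbox (fine N M')) × Fin (d + 1) → ℝ)
    {Q₁₀ : Matrix (↥(pbox M') × Fin (d + 1)) (↥(pbox (fine N M')) × Fin (d + 1)) ℝ}
    {D₁ : Matrix (↥(pbox (fine N M')) × Fin (d + 1)) (Res (ctr (d + 1) N) N (fine N M')) ℝ}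
    {D₂ : Matrix (↥(pbox (fine N M')) × Fin (d + 1)) (Res (toSite r') N M') ℝ}
    (hQ₁₀ : Q₁₀ = (perF (fine N M') (bhKStepSh d N (Dsh N) j)).submatrix
        (fun a : ↥(pbox M') × Fin (d + 1) => ((coarsePt M' N a.1, Sum.inr a.2) : Idx (fine N M') (Fib d)))
        (fun b : ↥(pbox (fine N M')) × Fin (d + 1) => ((b.1, Sum.inl b.2) : Idx (fine N M') (Fib d))))
    (hD₁ : D₁ = (tgrad (fine N M')).submatrix (fun b : ↥(pbox (fine N M')) × Fin (d + 1) => ((b.1, Sum.inl b.2) : Idx (fine N M') (Fib d)))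
        (Subtype.val : Res (ctr (d + 1) N) N (fine N M') → ↥(pbox (fine N M'))))
    (hD₂ : D₂ = (tgradBlock M' N).submatrix (fun b : ↥(pbox (fine N M')) × Fin (d + 1) => ((b.1, Sum.inl b.2) : Idx (fine N M') (Fib d)))
        (Subtype.val : Res (toSite r') N M' → ↥(pbox M'))) :
    (∑ b : ↥(pbox (fine N M')) × Fin (d + 1), h b •
          (perF (fine N M') (dper (fine N M') (symVhSAt (ctr (d + 1) N) d N rfl b.2 (b.1 : Site (d + 1))))).submatrix
            (fun a : ↥(pbox M') × Fin (d + 1) => ((coarsePt M' N a.1, Sum.inr a.2) : Idx (fine N M') (Fib d)))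
            (fun b : ↥(pbox (fine N M')) × Fin (d + 1) => ((b.1, Sum.inl b.2) : Idx (fine N M') (Fib d))))
        * fromCols D₂ D₁
      + Q₁₀ * ∑ b : ↥(pbox (fine N M')) × Fin (d + 1), h b •
          Matrix.of (fun (b' : ↥(pbox (fine N M')) × Fin (d + 1)) (e : Res (toSite r') N M' ⊕ Res (ctr (d + 1) N) N (fine N M')) =>
            if b' = b then
              -((((N : ℝ) ^ (d + 1) * stepScale d N j)⁻¹)
                * Sum.elim (fun t : Res (toSite r') N M' => tdelta M' (quo N ((b.1 : Site (d + 1)) + unitVec b.2)) t.1)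
                    (fun s : Res (ctr (d + 1) N) N (fine N M') => tdelta (fine N M') ((b.1 : Site (d + 1)) + unitVec b.2) s.1) e)
            else 0)
      = fromCols
          (∑ b : ↥(pbox (fine N M')) × Fin (d + 1), h b •
            Matrix.of fun (a : ↥(pbox M') × Fin (d + 1)) (t : Res (toSite r') N M') =>
              -((((N : ℝ) ^ (d + 1) * stepScale d N j)⁻¹) * Q₁₀ a b * tdelta M' ((a.1 : Site (d + 1)) + unitVec a.2) t.1))
          (0 : Matrix (↥(pbox M') × Fin (d + 1)) (Res (ctr (d + 1) N) N (fine N M')) ℝ) := by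
  refine weighted_letter h _ _ _ _ _ fun b => ?_
  obtain ⟨u, κ⟩ := b
  exact torus_c1_symVhSAt M' j κ u hQ₁₀ rfl hD₁ hD₂

end Summit.QuantumFields.BalabanUV.Beta.FP.PeriodisedSymBorderWardContactInstance

end
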